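import Summits.BirchSwinnertonDyer.BirchSwinnertonDyer.Theses.PrintCf2
import Summits.BirchSwinnertonDyer.Rank1Residual.WAll.AltClosersCMTwoRamifiedFamilies
import HarnessLib

/-!
# Route `PrintCf2`, item stmt-BirchSwinnertonDyer-20508 `RamifiedTYZFamiliesOfFacts` — CLOSED (cell `bsd-print-cf2`, p1)

HONEST FRAMING (cell `bsd-print-cf2`, run/shared/lean/pub/bsd-print-cf2/; route `PrintCf2`, leaf CornerF @ `p = 2` =
`WAllCornerFTwo`, OPEN AS A CLASS): a CLOSING file — it imports the route file and proves ONE item whose statement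
carries its published inputs as an antecedent (facts-relative «OfFacts» typing; nothing asserted, no named fact
introduced). The mathematics is in the seat's W-ALL files `Rank1Residual/WAll/TargetCMTwoRamifiedFamilies.lean`
(p533515), `…/AltClosersCMTwoRamifiedFamilies.lean` (p535702), `…/TargetCMTwoRamifiedOffTYZProved.lean` (p536500),
`…/AltClosersCMTwoRamifiedGenusClass.lean` (p538378); here only the one-line term. Strategy sentence (p1): «Tian–Yuan–Zhang
induction BY NAME … 2-part of BSD for E_n with controlled prime factorisations, typed as class theorems on explicit
infinite families».

THE ITEM: granted 𝔅_ram (the eleven published facts of the parent crux `RamifiedTwoRankOneOfFacts`), the leaf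
`WAllCornerFTwoRamifiedTYZProved` — BSD(E,2) for every globally minimal CM curve of analytic rank one with `2`
ramified that is a `ℚ`-model of a member of `CongruentTYZProvedFamily` (LLT ∨ Tian class 5 ∨ Tian class 7 ∨ Monsky
`3·5` ∨ TYZ-ρ). Facts used: TYZ17 Thm 1.2′, Tian14 Thm 1.3, Rédei–Reichardt, LLT24 Thm 1.2, Monsky90 Cor 5.15 (2), GZK
(conjuncts 5, 6, 7, 8, 9, 1 of 𝔅_ram). Beyond print: LLT, T5 NO; T7, M35, TYZρ YES (cell referee PROVED-by-name).
[cite: TianYuanZhang2017, Thm. 1.2] [cite: Tian2014, Thm. 1.3] [cite: LiLiuTian2024, Thm. 1.2]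
[cite: Monsky1990MockHeegner, Cor. 5.15 (2)] [cite: Miller2011LMS, Def. 1.1]
-/

noncomputable section

open scoped Classical

open Summit.BirchSwinnertonDyer Summit.BirchSwinnertonDyer.Rank1Residual.WAll
open Summit.BirchSwinnertonDyer.BirchSwinnertonDyer.Theses.PrintCf2

set_option autoImplicit false
-- `Summit.BirchSwinnertonDyer.BirchSwinnertonDyer.Theorems` is the layout's namespace (Sub = Summit name).
set_option linter.dupNamespace false

namespace Summit.BirchSwinnertonDyer.BirchSwinnertonDyer.Theorems

/-- **Item 20508 `RamifiedTYZFamiliesOfFacts` holds**: 𝔅_ram ⟹ `WAllCornerFTwoRamifiedTYZProved`, by the W-ALL closer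
`Rank1Residual.WAll.PrintCf2.wAllCornerFTwoRamifiedTYZProved_of_facts` (p535702).
[cite: TianYuanZhang2017, Thm. 1.2] [cite: Tian2014, Thm. 1.3] [cite: LiLiuTian2024, Thm. 1.2] [cite: Monsky1990MockHeegner, Cor. 5.15 (2)] -/
theorem ramifiedTYZFamiliesOfFacts_proof : RamifiedTYZFamiliesOfFacts :=
  fun hB ↦ Rank1Residual.WAll.PrintCf2.wAllCornerFTwoRamifiedTYZProved_of_facts hB.2.2.2.2.1 hB.2.2.2.2.2.1
    hB.2.2.2.2.2.2.1 hB.2.2.2.2.2.2.2.1 hB.2.2.2.2.2.2.2.2.1 hB.1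

end Summit.BirchSwinnertonDyer.BirchSwinnertonDyer.Theorems

end
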